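import Summits.KontsevichZagierPeriods.KontsevichZagierPeriods.Theses.ComplexOrientations
import Summits.KontsevichZagierPeriods.KontsevichZagierPeriods.Theses.AbelContraction
import Summits.KontsevichZagierPeriods.KontsevichZagierPeriods.Theorems.AbelContractionRealArcKernelSplit
import Summits.KontsevichZagierPeriods.KontsevichZagierPeriods.Theorems.ComplexOrientationsOrientationKernelReductionNecessity
import Summits.KontsevichZagierPeriods.KontsevichZagierPeriods.Theorems.ComplexOrientationsOrientationKernelRouteExactness

/-!
# KontsevichZagierPeriods / ComplexOrientations — the BC2 redirect of the target `OrientationKernel`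
# (item stmt-KontsevichZagierPeriods-11367; to be landed `--workitem stmt-KontsevichZagierPeriods-18007` (it closes the
# support item `OrientationKernelOfSubs`) or `--supports stmt-KontsevichZagierPeriods-11367`;
# split glue for `route edit --split OrientationKernel --into KZDimTwo ReductionToDimensionTwo --glue-by orientationKernel_of_subs`)

The target `OrientationKernel` of route `ComplexOrientations` (the kernel conjecture of the KZ calculus
enlarged by the route's oval / Cauchy relators) is RESTATED: the landed
`kontsevichZagierPeriods_iff_orientationKernel_and_ovalSector` makes it the summit modulo `OvalSector`,
and `OvalSector` follows from `PlanarAreas` (`ovalSector_of_planarAreas`), which is proved modulo the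
published theorem of Huber–Wüstholz (the cite-only fact `HuberWustholzCurvePeriods`, through the landed
`SymplecticScissors.PlanarTransport.planarAreas_of_huberWustholzCurvePeriods`). For the same reason the
cut of line `birth`, `ReductionToDimensionOne ∧ PlanarAreas → OrientationKernel`
(`orientationKernel_of_reductionToDimensionOne_of_planarAreas`, landed), is not a qualifying
decomposition: `ReductionToDimensionOne` (stmt-14403) is `≡` the summit modulo a published theorem.

This file records the decomposition of the target along the input-dimension filtration ONE OPEN LAYER
UP (route items of rev 2, crux-strategist `cstrat-stmt-KontsevichZagierPeriods-11367-r1`, 2026-08-17),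
the twin of `Theorems/AbelContractionRealArcKernelSplit.lean` for route AbelContraction's target:

* `KZDimTwo` (stmt-4280, shared with BianchiHumbert / HodgeLevel / DessinsDimensionOne / AbelContraction):
  Conjecture 1 on the dimension-two stratum — KZ-rational representations of dimensions `≤ 2` with equal
  values are KZ-equivalent;
* `ReductionToDimensionTwo` (stmt-18030, shared with AbelContraction): every subgroup `R ≥ KZ.relations`
  containing `[r] − [r′]` for every equal-valued pair of KZ-rational representations of dimensions `≤ 2`
  contains `ker KZ.eval`.

Proved here, sorry-free:
* `orientationKernel_of_subs : KZDimTwo → ReductionToDimensionTwo → OrientationKernel` — the ASSEMBLY (and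
  `orientationKernelOfSubs_proof : OrientationKernelOfSubs`, closing the support item stmt-18007 of rev 4)
  (pure logic: the stratum feeds the hypothesis of the reduction; the three relator hypotheses of the
  target are carried, not consumed);
* `reductionToDimensionTwo_of_orientationKernel : OrientationKernel → ReductionToDimensionTwo` — piece 2
  is NECESSARY (landed `reductionToDimensionOne_of_orientationKernel` + the monotonicity of the
  filtration `reductionToDimensionTwo_of_reductionToDimensionOne`);
* `kzDimTwo_iff_abel`, `reductionToDimensionTwo_iff_abel` — the pieces ARE AbelContraction's items
  (`Iff.rfl`);
* `ovalSector_of_kzDimTwo`, `typeOneIdentities_of_kzDimTwo` — piece 1 contains the route's own engines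
  (through the landed `planarAreas_of_kzDimTwo`, `ovalSector_of_planarAreas`,
  `typeOneIdentities_of_planarAreas`);
* `kzDimTwo_of_kontsevichZagierPeriods`, `reductionToDimensionTwo_of_kontsevichZagierPeriods` (both
  pieces are consequences of the summit), `closes_of_subs` (jointly they decide it THROUGH this route's
  deciding theorem `closes`).

Deliberately NOT here: any attack on `KZDimTwo` or `ReductionToDimensionTwo` themselves, and no
conditional `iff` (piece 2 is equivalent to the target / the summit only modulo the OPEN stratum
`KZDimTwo`).

Sources: M. Kontsevich, D. Zagier, *Periods* (2001), §1.2 (rules (1)–(3), Conjecture 1);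
A. Huber, S. Müller-Stach, *Periods and Nori Motives* (2017), Conj. 13.2.1 (kernel form).
-/

noncomputable section

open Literature.NumberTheory.Transcendental
open Summit.KontsevichZagierPeriods.KontsevichZagierPeriods.Theses.ComplexOrientations
  (OrientationKernel TypeOneIdentities OvalSector CauchyMove KZDimTwo ReductionToDimensionTwo)

namespace Summit.KontsevichZagierPeriods.ComplexOrientations.OrientationKernelSplit

/-! ## The assembly -/

/-- **Assembly of the redirect** `KZDimTwo → ReductionToDimensionTwo → OrientationKernel`: given an
admissible `R ≥ KZ.relations`, Conjecture 1 on the stratum puts `[r] − [r′]` for every equal-valued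
KZ-rational pair of dimensions `≤ 2` inside `KZ.relations ≤ R`, and the reduction then puts `ker KZ.eval`
inside `R`; the oval relators (families (i), (ii)) and the Cauchy relators (family (iii)) assumed on `R`
are not consumed. [cite: KontsevichZagier2001, §1.2 Conjecture 1] -/
theorem orientationKernel_of_subs : Summit.KontsevichZagierPeriods.KontsevichZagierPeriods.Theses.ComplexOrientations.KZDimTwo → Summit.KontsevichZagierPeriods.KontsevichZagierPeriods.Theses.ComplexOrientations.ReductionToDimensionTwo → Summit.KontsevichZagierPeriods.KontsevichZagierPeriods.Theses.ComplexOrientations.OrientationKernel :=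
  fun h₂ hRed R hR _ _ _ x hx => hRed R hR (fun _ _ hn hm r r' hr hr' hv => hR (h₂ hn hm r r' hr hr' hv)) x hx

/-- **Closes item stmt-KontsevichZagierPeriods-18007 `OrientationKernelOfSubs`** (the assembly filed as a
provable-now support item of the route, rev 4): by `orientationKernel_of_subs`. After landing, the split edge is
`route edit --split OrientationKernel --into children.json --glue-by <this decl or orientationKernel_of_subs>`.
[cite: KontsevichZagier2001, §1.2 Conjecture 1] -/
theorem orientationKernelOfSubs_proof :
    Summit.KontsevichZagierPeriods.KontsevichZagierPeriods.Theses.ComplexOrientations.OrientationKernelOfSubs :=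
  orientationKernel_of_subs

/-! ## The pieces are the shared items -/

/-- Piece 1 of this route IS the shared item stmt-4280 as filed in route AbelContraction.
[cite: KontsevichZagier2001, §1.2 Conjecture 1] -/
theorem kzDimTwo_iff_abel :
    KZDimTwo ↔ Summit.KontsevichZagierPeriods.KontsevichZagierPeriods.Theses.AbelContraction.KZDimTwo :=
  Iff.rfl

/-- Piece 2 of this route IS AbelContraction's item stmt-18030.
[cite: KontsevichZagier2001, §1.2 Conjecture 1] -/
theorem reductionToDimensionTwo_iff_abel :
    ReductionToDimensionTwo ↔
      Summit.KontsevichZagierPeriods.KontsevichZagierPeriods.Theses.AbelContraction.ReductionToDimensionTwo :=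
  Iff.rfl

/-! ## Strength of the pieces -/

/-- **Piece 2 is NECESSARY for the target**: `OrientationKernel → ReductionToDimensionTwo` (landed
`reductionToDimensionOne_of_orientationKernel`, p147979: an admissible `R` of stmt-14403 contains the
three relator families; then the monotonicity `reductionToDimensionTwo_of_reductionToDimensionOne`,
p148174: a one-dimensional pair is one Newton–Leibniz move away from a KZ-rational two-dimensional pair).
So no proof of the target avoids stmt-18030. [cite: KontsevichZagier2001, §1.2 Conjecture 1] -/
theorem reductionToDimensionTwo_of_orientationKernel (h : OrientationKernel) : ReductionToDimensionTwo :=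
  Summit.KontsevichZagierPeriods.AbelContraction.RealArcKernelSplit.reductionToDimensionTwo_of_reductionToDimensionOne
    (Summit.KontsevichZagierPeriods.ComplexOrientations.OrientationKernel.reductionToDimensionOne_of_orientationKernel h)

/-- The summit implies piece 1 (restriction of Conjecture 1 to the stratum).
[cite: KontsevichZagier2001, §1.2 Conjecture 1] -/
theorem kzDimTwo_of_kontsevichZagierPeriods (h : KontsevichZagierPeriods) : KZDimTwo :=
  fun _ _ _ _ r r' hr hr' hv => h r r' hr hr' hv

/-- The summit implies piece 2 (landed for AbelContraction's copy; `Iff.rfl` transport).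
[cite: KontsevichZagier2001, §1.2 Conjecture 1] -/
theorem reductionToDimensionTwo_of_kontsevichZagierPeriods (h : KontsevichZagierPeriods) :
    ReductionToDimensionTwo :=
  Summit.KontsevichZagierPeriods.AbelContraction.RealArcKernelSplit.reductionToDimensionTwo_of_kontsevichZagierPeriods h

/-- Piece 1 contains the 1-period layer `PlanarAreas` (stmt-4990): the integrand `1` is KZ-rational
(landed `planarAreas_of_kzDimTwo`). [cite: KontsevichZagier2001, §1.1 Definition] -/
theorem planarAreas_of_kzDimTwo (h₂ : KZDimTwo) :
    Summit.KontsevichZagierPeriods.KontsevichZagierPeriods.Theses.AbelContraction.PlanarAreas :=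
  Summit.KontsevichZagierPeriods.AbelContraction.RealArcKernelSplit.planarAreas_of_kzDimTwo h₂

/-- Piece 1 contains the route's programme crux `OvalSector` (landed `ovalSector_of_planarAreas`,
p150030: every integer oval-sector identity is an equality of areas of two bounded planar
integrand-`1` representations after a disjoint-translation merge). [cite: KontsevichZagier2001, §1.2] -/
theorem ovalSector_of_kzDimTwo (h₂ : KZDimTwo) : OvalSector :=
  Summit.KontsevichZagierPeriods.ComplexOrientations.OrientationKernel.ovalSector_of_planarAreas
    (planarAreas_of_kzDimTwo h₂)

/-- Piece 1 contains the route's engine `TypeOneIdentities` (landed `typeOneIdentities_of_planarAreas`).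
[cite: KontsevichZagier2001, §1.2] -/
theorem typeOneIdentities_of_kzDimTwo (h₂ : KZDimTwo) : TypeOneIdentities :=
  Summit.KontsevichZagierPeriods.ComplexOrientations.OrientationKernel.typeOneIdentities_of_planarAreas
    (planarAreas_of_kzDimTwo h₂)

/-- **The two pieces jointly decide the summit THROUGH this route's deciding theorem**: `closes` fed with
`TypeOneIdentities`, `OvalSector` (both from piece 1), the closed support `CauchyMove`
(`cauchyMove_proof`) and the target (from the assembly). [cite: KontsevichZagier2001, §1.2 Conjecture 1] -/
theorem closes_of_subs (h₂ : KZDimTwo) (hRed : ReductionToDimensionTwo) : KontsevichZagierPeriods :=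
  Summit.KontsevichZagierPeriods.KontsevichZagierPeriods.Theses.ComplexOrientations.closes
    (typeOneIdentities_of_kzDimTwo h₂) (ovalSector_of_kzDimTwo h₂)
    Summit.KontsevichZagierPeriods.ComplexOrientations.cauchyMove_proof (orientationKernel_of_subs h₂ hRed)

/-- The same conclusion through AbelContraction's landed `kontsevichZagierPeriods_of_subs` (the pieces
decide the summit independently of this route's engines). [cite: KontsevichZagier2001, §1.2 Conjecture 1] -/
theorem kontsevichZagierPeriods_of_subs (h₂ : KZDimTwo) (hRed : ReductionToDimensionTwo) :
    KontsevichZagierPeriods :=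
  Summit.KontsevichZagierPeriods.AbelContraction.RealArcKernelSplit.kontsevichZagierPeriods_of_subs h₂ hRed

/-- The rejected piece of line `birth` implies the new tail: `ReductionToDimensionOne → ReductionToDimensionTwo`
(monotonicity, landed). [cite: KontsevichZagier2001, §1.2] -/
theorem reductionToDimensionTwo_of_reductionToDimensionOne
    (h : Summit.KontsevichZagierPeriods.KontsevichZagierPeriods.Theses.AbelContraction.ReductionToDimensionOne) :
    ReductionToDimensionTwo :=
  Summit.KontsevichZagierPeriods.AbelContraction.RealArcKernelSplit.reductionToDimensionTwo_of_reductionToDimensionOne h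

/-- **Special case of piece 2 (proved)**: the reduction holds on the part of `ker KZ.eval` generated by
representations of dimensions `≤ 1` (landed `reductionToDimensionTwo_on_dimLEOne`, transported by `Iff.rfl`).
[cite: KontsevichZagier2001, §1.2] -/
theorem reductionToDimensionTwo_on_dimLEOne :
    ∀ R : AddSubgroup KZ.FormalRep, KZ.relations ≤ R →
      (∀ ⦃n m : ℕ⦄, n ≤ 2 → m ≤ 2 → ∀ (r : KZ.IntegralRep n) (r' : KZ.IntegralRep m),
        r.IsRational → r'.IsRational → r.value = r'.value → KZ.of r - KZ.of r' ∈ R) →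
      ∀ x ∈ AddSubgroup.closure
          ({x : KZ.FormalRep | ∃ r : KZ.IntegralRep 1, x = KZ.of r} ∪
            {x : KZ.FormalRep | ∃ c : KZ.IntegralRep 0, x = KZ.of c}),
        KZ.eval x = 0 → x ∈ R :=
  Summit.KontsevichZagierPeriods.AbelContraction.RealArcKernelSplit.reductionToDimensionTwo_on_dimLEOne

end Summit.KontsevichZagierPeriods.ComplexOrientations.OrientationKernelSplit

end
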